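import Summits.HodgeConjecture.HodgeConjecture.Theorems.Ring2TransportSemiregularGerm
import Summits.HodgeConjecture.HodgeConjecture.Theorems.Ring2TransportWeilTypeGeneralCMFieldSU
import HarnessLib

/-!
# Ring-2 transport, gen 5 (κ): the LOCAL germ at CM fibres and the semiregular Chern lift — CM fields `K`, `[K:ℚ] > 2`

HONEST FRAMING (page 1, verbatim for the cell). Everything in this file is a RESEARCH ROUTE CONDITIONAL ON `HC_CM`
(`Theses.RankFourFaces.CMAbelianHodge`, an explicit binder `hCM`, never a fact); NOT a corollary of anything in
print; Question 11.4 SENTENCE 2 of Markman's survey (the weak semiregularity criterion) is ALREADY REFUTED in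
dimension ≥ 3 (`SemiregularityWeakCriterionAbelianCounterexample`, `…Full`) and is used nowhere below. The preprints
[M] arXiv:2502.03415, [S] arXiv:2509.23403, [C] arXiv:2509.23079, [P] arXiv:2604.00511 are UNREFEREED and enter only
as cited statements, never as inputs of a theorem. No internally-minted statement is cited as a fact: the two new
named statements of this file (`LocalWeilVHCAtCMField`, `SemiregularChernLiftAtCMField C`) are OURS, OPEN, typed
missing inputs (`@[conjecture]`), and appear only as hypotheses.

WHAT THIS FILE ADDS (mandate (ii)/(iii) of the transport seat, for CM fields of degree `> 2` — the case §12 of [S]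
leaves open). Gens 1–3 gave the CM-field rung R3 (`WeilTypeLadder.WeilClassesCMField`) and the class target T6-CM
(`HodgeGeneralWeilTypeCMField`, gen 5) only from the GLOBAL Weil-confined variational hypothesis R3var
(`WeilVariationalHodgeCMField`); the LOCAL germ leaf — the exact output shape of STRICT semiregularity (Bloch 1972,
Buchweitz–Flenner 2003 Thm. 5.1), required only at CM-presented algebraic fibres — existed only for imaginary
quadratic `K` (gen 1 `LocalWeilVHCAtCMQuadratic`, gen 5 `SemiregularChernLiftAtCMQuadratic`). Here:

* `LocalWeilVHCAtCMField` — the CM-field local germ leaf (binders of R3var and of gen 1's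
  `CMPointedWeilFamiliesCMField`; conclusion: a Euclidean-open `U ∋ s₀` of algebraic fibres at every CM-presented
  fibre `s₀` on which `W|_{𝒳_{s₀}}` is algebraic). ON-PATH (`localWeilVHCAtCMField_of_hodgeConjecture`), WEAKER than
  R3var (`localWeilVHCAtCMField_of_weilVariationalHodgeCMField`).
* `HC_WeilClassesCMField_of_HC_CM_local : HC_CM → CMPointedWeilFamiliesCMField → LocalWeilVHCAtCMField → R3` —
  one CM fibre (algebraic by `HC_CM`), the local germ, and analytic continuation of the algebraicity locus over the
  smooth irreducible quasi-projective base (Baire + Charles–Schnell, tree lemma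
  `mem_algebraicClasses_of_isOpen_subset_algebraicityLocus`); and its `HC_CM`-FREE twin through gen 2's
  divisor-generated CM anchors (`HC_WeilClassesCMField_of_divisorGeneratedCMPointed_local`; honest column: for
  `[K:ℚ] > 2` that leaf is the ANCHOR-GOOD hypothesis of gen 2, not a theorem).
* `SemiregularChernLiftAtCMField C` — H-T3-germ over CM fields: at a CM-presented algebraic fibre, `W|_{𝒳_{s₀}}` is a
  `ℂ`-combination of `ch_m` of finitely many `I`-semiregular finite locally free sheaves whose Chern characters stay
  of Hodge type along paths near `s₀` (the hypothesis package of `BuchweitzFlenner2003_variationalHodge_ISemiregular`).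
  HONEST LABEL: plausibly FALSE as a `∀`-statement (obstructed representatives are generic); per-family witnesses are
  the intended use; NOT a case of HC; no on-path lemma.
* `localWeilVHCAtCMField_of_semiregularChernLift : BF2003 → SemiregularChernLiftAtCMField C → LocalWeilVHCAtCMField`
  — kernel-checked, literature input REFEREED (Buchweitz–Flenner 2003 Thm. 5.1; Ehresmann local triviality and local
  path-connectedness of `S(ℂ)` from the tree), verbatim the quadratic proof of gen 5 with `(2n, n) ↦ (e·m, m)`.
* Rows: T7-germ-K (`HC_WeilClassesCMField_of_HC_CM_of_semiregularChernLift`), T6-CM-local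
  (`HC_GeneralWeilTypeCMField_of_HC_CM_local`, through gen 5's `hodgeGeneralWeilTypeCMField_of_weilClassesCMField`,
  hence with the descent binder `WeilClassesFieldRationallySpanned`; the irreducible instance that removes it is
  `Literature/…/WeilClassesFieldRationalSpan.lean` + `Theorems/Ring2TransportWeilTypeGeneralCMFieldDescent.lean`),
  T6-CM-germ (`HC_GeneralWeilTypeCMField_of_HC_CM_of_semiregularChernLift`), and `localGermCMField_position`.

NO-GO recorded, not used: the weak criterion (W)/(W_T) of [S] Question 11.4 sentence 2 is refuted for abelian
varieties of dimension ≥ 3; "CM-dense ⟹ spreads" is refuted (`Markman2025.cmDensity_insufficient`). The surviving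
weaker hypotheses typed by the cell are, from strongest to weakest literature-shaped input: R3var (global VHC in the
family) ⟸ … ; `LocalWeilVHCAtCMField` (germ at CM fibres) ⟸ `SemiregularChernLiftAtCMField C` + BF 2003.

References (bib keys): BuchweitzFlenner2003 (§5 Thm. 5.1, Def. 4.1), Bloch1972Semiregularity (Thm. (7.1), Remark
(7.5)), CharlesSchnell2014Notes (Conj. 11.3.1, Cor. 11.3.6, Prop. 11.3.11), VoisinHodgeI2002 (§9.2.1),
VoisinHodgeII2003 (§3.1.2), Deligne1982HodgeCycles (§4 Prop. 4.4, Thm. 4.8, §5, endnote 16), MoonenZarhin1998WeilClasses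
(§1), Mumford1969NoteShimura (§3), Gordon1997 (Thm. 6.4, §3), Markman2025SurveySecant ([S] Question 11.4, §12 —
preprint / ICM 2026 lecture, unrefereed, statements only), Markman2025SecantRealMultiplication ([C] §9.2, Cor. 10.2.3 —
preprint, unrefereed, statements only).
-/

set_option linter.dupNamespace false

noncomputable section

open CategoryTheory

namespace Summit.HodgeConjecture.HodgeConjecture.Ring2Transport

open Literature.AlgebraicGeometry Literature.AlgebraicGeometry.Motives
open Literature.AlgebraicGeometry.HodgeTheory
open Literature.AlgebraicGeometry.Deligne1982
open Literature.AlgebraicTopology.SingularHomology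
open Literature.AlgebraicGeometry.Milne1999 (IsOfCMType)
open Summit.HodgeConjecture.HodgeConjecture.WeilTypeLadder
open Summit.HodgeConjecture.HodgeConjecture.Theses

/-! ### §1 The local germ leaf at CM fibres, CM field `K = ℚ[T]/(P)` of degree `e > 2` -/

/-- **LOCAL Weil-confined variational Hodge AT CM FIBRES, CM field `K` of degree `e > 2` (typed missing input;
OURS, open, Summit-side leaf — NOT a Literature fact).** In the binders of R3var (`WeilVariationalHodgeCMField`:
`P ∈ ℤ[T]` monic irreducible of degree `e`, no real root, one `Q ∈ ℚ[T]` inducing complex conjugation on the roots,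
`m ≥ 1`; a smooth projective family `f : 𝒳 ⟶ S` of relative dimension `e·m` over a smooth irreducible
quasi-projective base, a global class `W ∈ H^{2m}(𝒳)` fibrewise rational of type `(m,m)` and confined to
`W_K ⊗ ℂ = weilClassesField` through charts) and additionally `e > 2`: for every complex point `s₀` whose fibre is
PRESENTED BY A CM ABELIAN VARIETY of dimension `e·m` and on which `W|_{𝒳_{s₀}}` is ALGEBRAIC there is a
Euclidean-open `U ∋ s₀` of `S(ℂ)` with `W|_{𝒳_t}` algebraic for all `t ∈ U` — the OUTPUT SHAPE of strict
semiregularity (Bloch 1972 Thm. (7.1); Buchweitz–Flenner 2003 Thm. 5.1) at a semiregular representative on the CM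
fibre, NOT the refuted weak criterion. WEAKER than R3var (`localWeilVHCAtCMField_of_weilVariationalHodgeCMField`) and
than the local form of R3var at ARBITRARY algebraic fibres (hypothesis `hloc` of
`WeilTypeLadder.weilClassesCMField_of_anchored_of_local`); a CASE of the summit
(`localWeilVHCAtCMField_of_hodgeConjecture`). OPEN. [cite: BuchweitzFlenner2003, Thm. 5.1 and Thm. 5.2]
[cite: Bloch1972Semiregularity, Thm. (7.1) and Remark (7.5)] [cite: CharlesSchnell2014Notes, Conj. 11.3.1 and Prop. 11.3.11]
[cite: Markman2025SurveySecant, Question 11.4 and §12 (preprint / ICM 2026 lecture, unrefereed)] [status: open] -/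
@[conjecture] def LocalWeilVHCAtCMField : Prop :=
  ∀ (P : Polynomial ℤ) (e m : ℕ), P.Monic → P.natDegree = e → 2 < e → Irreducible (P.map (Int.castRingHom ℚ)) →
    (∀ ρ : ℂ, Polynomial.eval₂ (Int.castRingHom ℂ) ρ P = 0 → starRingEnd ℂ ρ ≠ ρ) →
    (∃ Q : Polynomial ℚ, ∀ ρ : ℂ, Polynomial.eval₂ (Int.castRingHom ℂ) ρ P = 0 →
        Polynomial.eval₂ (algebraMap ℚ ℂ) ρ Q = starRingEnd ℂ ρ) →
    1 ≤ m →
    ∀ ⦃𝒳 S : Motives.SchemeOver ℂ⦄ (f : 𝒳 ⟶ S), Motives.IsSmoothProjectiveFamily f (e * m) →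
      IsQuasiProjectiveOver 𝒳 → IsQuasiProjectiveOver S → IrreducibleSpace S.left →
      AlgebraicGeometry.Smooth S.hom →
      ∀ (W : complexBetti 𝒳 (2 * m)),
        (∀ s : Motives.ComplexPoints S,
          IsRationalClass (complexBetti.map (Motives.fiberι f s) (2 * m) W) ∧
            IsOfHodgeType (e * m) (Motives.fiberOver f s) (2 * m) m m
              (complexBetti.map (Motives.fiberι f s) (2 * m) W)) →
        (∀ s : Motives.ComplexPoints S, ∃ (A' : Motives.AbelianVariety ℂ) (φ' : A' ⟶ A')
            (e' : A'.X ≅ Motives.fiberOver f s),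
          Polynomial.eval₂ (Int.castRingHom (CategoryTheory.End A')) (φ' : CategoryTheory.End A') P = 0 ∧
            e * (2 * m) = 2 * A'.dim ∧
            complexBetti.map e'.hom (2 * m) (complexBetti.map (Motives.fiberι f s) (2 * m) W) ∈
              weilClassesField A' φ' P (2 * m)) →
        ∀ s₀ : Motives.ComplexPoints S,
          (∃ A₀ : Motives.AbelianVariety ℂ,
              Nonempty (A₀.X ≅ Motives.fiberOver f s₀) ∧ A₀.dim = e * m ∧ IsOfCMType A₀) →
          complexBetti.map (Motives.fiberι f s₀) (2 * m) W ∈ algebraicClasses (Motives.fiberOver f s₀) m →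
          ∃ U : Set (Motives.ComplexPoints S), IsOpen U ∧ s₀ ∈ U ∧
            ∀ t ∈ U, complexBetti.map (Motives.fiberι f t) (2 * m) W ∈ algebraicClasses (Motives.fiberOver f t) m

/-- ON-PATH (C6): `LocalWeilVHCAtCMField` is a case of the summit (`U = S(ℂ)`).
[cite: CharlesSchnell2014Notes, Cor. 11.3.6 (p. 479)] -/
theorem localWeilVHCAtCMField_of_hodgeConjecture (h : _root_.HodgeConjecture) : LocalWeilVHCAtCMField :=
  fun _ _ m _ _ _ _ _ _ _ _ _ _ hf _ _ _ _ _ hW _ s₀ _ _ ↦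
    ⟨Set.univ, isOpen_univ, Set.mem_univ s₀, fun t _ ↦ (h (hf.isSmoothProjective t)).2 m _ (hW t).1 (hW t).2⟩

/-- `LocalWeilVHCAtCMField` is WEAKER than the global leaf R3var (`U = S(ℂ)`; the CM chart and `e > 2` unused).
[cite: CharlesSchnell2014Notes, Conj. 11.3.1 (p. 477)] -/
theorem localWeilVHCAtCMField_of_weilVariationalHodgeCMField (hV : WeilVariationalHodgeCMField) :
    LocalWeilVHCAtCMField :=
  fun P e m hPm hPe _ hirr hnr hQ hm _ _ f hf h𝒳 hS hirrS hsm W hW hWeil s₀ _ hs₀ ↦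
    ⟨Set.univ, isOpen_univ, Set.mem_univ s₀,
      fun t _ ↦ hV P e m hPm hPe hirr hnr hQ hm f hf h𝒳 hS hirrS hsm W hW hWeil ⟨s₀, hs₀⟩ t⟩

/-! ### §2 R3 from `HC_CM`, CM-pointed `K`-Weil families and the LOCAL germ at CM fibres -/

/-- **`HC_WeilClassesCMField_of_HC_CM_local` — the Weil classes for every CM field `K` of degree `> 2` (rung R3)
from `HC_CM`, CM-pointed `K`-Weil families and the LOCAL germ at CM fibres.** `HC_CM` makes `W|_{𝒳_{s₀}}`
algebraic on the CM fibre (`mem_algebraicClasses_of_cmChart`); the local leaf gives a Euclidean-open `U ∋ s₀` of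
algebraic fibres; Baire + Charles–Schnell over the smooth irreducible quasi-projective base
(`mem_algebraicClasses_of_isOpen_subset_algebraicityLocus`) makes EVERY fibre algebraic, in particular
`𝒳_{s₁} ≅ A.X`; read back along `ι`. The case `m = 0` is `H⁰` (`algebraicClasses_zero`). CONDITIONAL on all three
named hypotheses (two of them ours and open). ON-PATH lemma of the target = tree
`WeilTypeLadder.weilClassesCMField_of_hodgeConjecture`. [cite: CharlesSchnell2014Notes, Prop. 11.3.11 (proof)]
[cite: Deligne1982HodgeCycles, §4, proof of Thm. 4.8 (a)–(c) and §5] [cite: BuchweitzFlenner2003, Thm. 5.1]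
[cite: Markman2025SurveySecant, §12 (preprint / ICM 2026 lecture, unrefereed)] -/
theorem HC_WeilClassesCMField_of_HC_CM_local (hCM : Theses.RankFourFaces.CMAbelianHodge)
    (hP : CMPointedWeilFamiliesCMField) (hL : LocalWeilVHCAtCMField) : WeilClassesCMField := by
  intro A φ P e m hPm hPe he hirr hφ hdim hnr hQ c hc hcQ hcH
  by_cases hc0 : c = 0
  · rw [hc0]; exact Submodule.zero_mem _
  rcases Nat.eq_zero_or_pos m with hm0 | hm
  · subst hm0
    rw [algebraicClasses_zero]
    exact Submodule.mem_top
  obtain ⟨𝒳, S, f, s₁, s₀, ι, W, hf, h𝒳, hS, hirrS, hsm, hW, hWeil, hread, A₀, ⟨e₀⟩, hA₀dim, hA₀cm⟩ :=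
    hP A φ P e m hPm hPe he hirr hφ hdim hnr hQ c hc hcQ hcH hc0
  haveI := hirrS
  have hs₀ : complexBetti.map (fiberι f s₀) (2 * m) W ∈ algebraicClasses (fiberOver f s₀) m :=
    mem_algebraicClasses_of_cmChart hCM A₀ e₀ hA₀dim hA₀cm (hW s₀).1 (hW s₀).2
  obtain ⟨U, hU, hs₀U, hUalg⟩ :=
    hL P e m hPm hPe he hirr hnr hQ hm f hf h𝒳 hS hirrS hsm W hW hWeil s₀ ⟨A₀, ⟨e₀⟩, hA₀dim, hA₀cm⟩ hs₀
  have h1 : complexBetti.map (fiberι f s₁) (2 * m) W ∈ algebraicClasses (fiberOver f s₁) m :=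
    mem_algebraicClasses_of_isOpen_subset_algebraicityLocus f h𝒳 hS hsm hf W hU ⟨s₀, hs₀U⟩ hUalg s₁
  rw [← hread]
  exact (mem_algebraicClasses_map_iff_of_iso ι).2 h1

/-- **The `HC_CM`-FREE twin: R3 from gen 2's divisor-generated CM-pointed `K`-Weil families and the local germ at
CM fibres.** The CM fibre's rational `(m,m)` classes lie in `Dᵐ ⊗ ℂ`, hence are algebraic by Lefschetz (1,1)
(`mem_algebraicClasses_of_divisorGeneratedChart`); then as above. HONEST COLUMN: for `[K:ℚ] > 2` the leaf
`DivisorGeneratedCMPointedWeilFamiliesCMField` is gen 2's ANCHOR-GOOD hypothesis (Hazama/Gordon `Hdg = Div` on powers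
of a nondegenerate simple CM factor), open as typed. [cite: Gordon1997, Thm. 6.4 and §3 Theorem]
[cite: CharlesSchnell2014Notes, Prop. 11.3.11 (proof)] -/
theorem HC_WeilClassesCMField_of_divisorGeneratedCMPointed_local (hP : DivisorGeneratedCMPointedWeilFamiliesCMField)
    (hL : LocalWeilVHCAtCMField) : WeilClassesCMField := by
  intro A φ P e m hPm hPe he hirr hφ hdim hnr hQ c hc hcQ hcH
  by_cases hc0 : c = 0
  · rw [hc0]; exact Submodule.zero_mem _
  rcases Nat.eq_zero_or_pos m with hm0 | hm
  · subst hm0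
    rw [algebraicClasses_zero]
    exact Submodule.mem_top
  obtain ⟨𝒳, S, f, s₁, s₀, ι, W, hf, h𝒳, hS, hirrS, hsm, hW, hWeil, hread, A₀, ⟨e₀⟩, hA₀dim, hA₀cm, hgen⟩ :=
    hP A φ P e m hPm hPe he hirr hφ hdim hnr hQ c hc hcQ hcH hc0
  haveI := hirrS
  have hs₀ : complexBetti.map (fiberι f s₀) (2 * m) W ∈ algebraicClasses (fiberOver f s₀) m :=
    mem_algebraicClasses_of_divisorGeneratedChart A₀ e₀ hA₀dim hgen (hW s₀).1 (hW s₀).2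
  obtain ⟨U, hU, hs₀U, hUalg⟩ :=
    hL P e m hPm hPe he hirr hnr hQ hm f hf h𝒳 hS hirrS hsm W hW hWeil s₀ ⟨A₀, ⟨e₀⟩, hA₀dim, hA₀cm⟩ hs₀
  have h1 : complexBetti.map (fiberι f s₁) (2 * m) W ∈ algebraicClasses (fiberOver f s₁) m :=
    mem_algebraicClasses_of_isOpen_subset_algebraicityLocus f h𝒳 hS hsm hf W hU ⟨s₀, hs₀U⟩ hUalg s₁
  rw [← hread]
  exact (mem_algebraicClasses_map_iff_of_iso ι).2 h1

/-! ### §3 The semiregular Chern lift at CM fibres over CM fields, and the refereed germ theorem -/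

/-- **H-T3-germ-K `SemiregularChernLiftAtCMField C` (typed missing input; OURS, open, Summit-side — NOT a Literature
fact).** In the binders of `LocalWeilVHCAtCMField` (CM field `K = ℚ[T]/(P)` of degree `e > 2`, `m ≥ 1`, a smooth
projective `K`-Weil family of relative dimension `e·m`, a global class `W` fibrewise rational of type `(m,m)` and
confined to `W_K ⊗ ℂ` through charts, a CM-presented fibre `s₀` on which `W|_{𝒳_{s₀}}` is ALGEBRAIC): there are a
Euclidean-open `U ∋ s₀`, finitely many finite locally free sheaves `E_i` on `𝒳_{s₀}` with finite degree sets
`I_i ∋ m`, `E_i` `I_i`-semiregular in the sense of Buchweitz–Flenner (`IsISemiregular`), complex coefficients `c_i`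
with `W|_{𝒳_{s₀}} = Σ_i c_i · ch_m(E_i)` for the Chern character theory `C`, and, for every `i` and `p ∈ I_i`, the
flat transport of `ch_p(E_i)` along every path in `U` from `s₀` is of type `(p,p)` — exactly the hypothesis package
of `BuchweitzFlenner2003_variationalHodge_ISemiregular`, `ℂ`-linearly extended; verbatim gen 5's
`SemiregularChernLiftAtCMQuadratic C` with `(2n, n, ℚ(√-d)) ↦ (e·m, m, K)`. CLOSEST PRINT (semiregular sheaf GIVEN,
never produced from algebraicity): Bloch 1972 Thm. (7.1); Buchweitz–Flenner 2003 Thm. 5.1; [S] Question 11.4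
SENTENCE 1 (open; sentence 2 REFUTED in dim ≥ 3). HONEST LABEL: PLAUSIBLY FALSE AS A `∀`-STATEMENT (obstructed
representatives are generic); the intended use is a per-family witness; NOT a case of HC (its conclusion asserts
sheaves); no on-path lemma. NOT asserted. [cite: BuchweitzFlenner2003, §5 Thm. 5.1 and Def. 4.1]
[cite: Bloch1972Semiregularity, Thm. (7.1) and Remark (7.5)]
[cite: Markman2025SurveySecant, Question 11.4 sentence 1 and §12 (preprint / ICM 2026 lecture, unrefereed)] [status: open] -/
@[conjecture] def SemiregularChernLiftAtCMField (C : ChernCharacterBetti) : Prop :=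
  ∀ (P : Polynomial ℤ) (e m : ℕ), P.Monic → P.natDegree = e → 2 < e → Irreducible (P.map (Int.castRingHom ℚ)) →
    (∀ ρ : ℂ, Polynomial.eval₂ (Int.castRingHom ℂ) ρ P = 0 → starRingEnd ℂ ρ ≠ ρ) →
    (∃ Q : Polynomial ℚ, ∀ ρ : ℂ, Polynomial.eval₂ (Int.castRingHom ℂ) ρ P = 0 →
        Polynomial.eval₂ (algebraMap ℚ ℂ) ρ Q = starRingEnd ℂ ρ) →
    1 ≤ m →
    ∀ ⦃𝒳 S : Motives.SchemeOver ℂ⦄ (f : 𝒳 ⟶ S), Motives.IsSmoothProjectiveFamily f (e * m) →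
      IsQuasiProjectiveOver 𝒳 → IsQuasiProjectiveOver S → IrreducibleSpace S.left →
      AlgebraicGeometry.Smooth S.hom →
      ∀ (W : complexBetti 𝒳 (2 * m)),
        (∀ s : Motives.ComplexPoints S,
          IsRationalClass (complexBetti.map (Motives.fiberι f s) (2 * m) W) ∧
            IsOfHodgeType (e * m) (Motives.fiberOver f s) (2 * m) m m
              (complexBetti.map (Motives.fiberι f s) (2 * m) W)) →
        (∀ s : Motives.ComplexPoints S, ∃ (A' : Motives.AbelianVariety ℂ) (φ' : A' ⟶ A')
            (e' : A'.X ≅ Motives.fiberOver f s),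
          Polynomial.eval₂ (Int.castRingHom (CategoryTheory.End A')) (φ' : CategoryTheory.End A') P = 0 ∧
            e * (2 * m) = 2 * A'.dim ∧
            complexBetti.map e'.hom (2 * m) (complexBetti.map (Motives.fiberι f s) (2 * m) W) ∈
              weilClassesField A' φ' P (2 * m)) →
        ∀ s₀ : Motives.ComplexPoints S,
          (∃ A₀ : Motives.AbelianVariety ℂ,
              Nonempty (A₀.X ≅ Motives.fiberOver f s₀) ∧ A₀.dim = e * m ∧ IsOfCMType A₀) →
          complexBetti.map (Motives.fiberι f s₀) (2 * m) W ∈ algebraicClasses (Motives.fiberOver f s₀) m →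
          ∃ (U : Set (Motives.ComplexPoints S)) (hs₀ : s₀ ∈ U), IsOpen U ∧
            ∃ (r : ℕ) (c : Fin r → ℂ) (E : Fin r → (Motives.fiberOver f s₀).left.Modules)
              (hE : ∀ i, Motives.IsFiniteLocallyFree (E i)) (Ideg : Fin r → Finset ℕ),
              (∀ i, m ∈ Ideg i) ∧ (∀ i, IsISemiregular (hE i) {q | q + 1 ∈ Ideg i}) ∧
              complexBetti.map (Motives.fiberι f s₀) (2 * m) W =
                  ∑ i, c i • C.ch (Motives.fiberOver f s₀) (E i) m ∧
              ∀ (hU : IsCohomologicallyLocallyTrivialOn f U) (i : Fin r), ∀ p ∈ Ideg i,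
                ∀ (t : U) (γ : Path.Homotopic.Quotient (⟨s₀, hs₀⟩ : U) t),
                  IsOfHodgeType (e * m) (Motives.fiberOver f t.1) (2 * p) p p
                    (transportFun f (2 * p) hU γ (C.ch (Motives.fiberOver f s₀) (E i) p))

/-- **`LocalWeilVHCAtCMField` from the semiregular Chern lift at CM fibres and Buchweitz–Flenner's theorem
(kernel-checked composition; literature input REFEREED).** Verbatim the quadratic proof
(`localWeilVHCAtCMQuadratic_of_semiregularChernLift`): write `W|_{s₀} = Σ c_i ch_m(E_i)`; the base is cohomologically
locally trivial (Ehresmann, `isCohomologicallyLocallyTrivialOn_univ_of_isQuasiProjectiveOver`); Buchweitz–Flenner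
Thm. 5.1 gives opens `W_i ∋ s₀` over which the transports of `ch_m(E_i)` are algebraic; on the path component of
`s₀` in `U ∩ ⋂ W_i` (open: `S(ℂ)` is locally path connected) every fibre class is the `ℂ`-linear transport of
`W|_{s₀}` along a path inside it. [cite: BuchweitzFlenner2003, §5 Thm. 5.1] [cite: VoisinHodgeI2002, §9.2.1]
[cite: VoisinHodgeII2003, §3.1.2] -/
theorem localWeilVHCAtCMField_of_semiregularChernLift (C : ChernCharacterBetti)
    (hBF : BuchweitzFlenner2003_variationalHodge_ISemiregular)
    (hL : SemiregularChernLiftAtCMField C) : LocalWeilVHCAtCMField := by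
  intro P e m hPm hPe he hirrP hnr hQ hm 𝒳 S f hf hq𝒳 hqS hirr hsm W hW hch s₀ hA₀ halg
  obtain ⟨U, hs₀U, hUo, r, c, E, hE, Ideg, hmI, hsr, hsum, hHodge⟩ :=
    hL P e m hPm hPe he hirrP hnr hQ hm f hf hq𝒳 hqS hirr hsm W hW hch s₀ hA₀ halg
  have hU : IsCohomologicallyLocallyTrivialOn f U :=
    (isCohomologicallyLocallyTrivialOn_univ_of_isQuasiProjectiveOver f hf hqS hsm).mono (Set.subset_univ U) hUo
  -- Buchweitz–Flenner, sheaf by sheaf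
  have hBFi : ∀ i : Fin r, ∃ (Wi : Set (ComplexPoints S)) (hWo : IsOpen Wi) (hW₀ : s₀ ∈ Wi) (hWU : Wi ⊆ U),
      ∀ (t : Wi) (γ : Path.Homotopic.Quotient (⟨s₀, hW₀⟩ : Wi) t),
        transportFun f (2 * m) (hU.mono hWU hWo) γ (C.ch (fiberOver f s₀) (E i) m) ∈
          algebraicClasses (fiberOver f t.1) m := by
    intro i
    obtain ⟨Wi, hWo, hW₀, hWU, h⟩ := hBF C f (e * m) hf hsm hU ⟨s₀, hs₀U⟩ (E i) (hE i) (Ideg i) (hsr i)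
      (fun p hp t γ ↦ hHodge hU i p hp t γ)
    exact ⟨Wi, hWo, hW₀, hWU, fun t γ ↦ h m (hmI i) t γ⟩
  choose Wi hWio hW₀i hWiU hWialg using hBFi
  -- the path component of `s₀` in `U ∩ ⋂ Wi`
  haveI := hsm
  haveI : LocallyPathConnectedSpace (ComplexPoints S) := locallyPathConnectedSpace_complexPoints_of_smooth S
  set W₀ : Set (ComplexPoints S) := U ∩ ⋂ i, Wi i with hW₀def
  have hW₀o : IsOpen W₀ := hUo.inter (isOpen_iInter_of_finite hWio)
  have hs₀W₀ : s₀ ∈ W₀ := ⟨hs₀U, Set.mem_iInter.2 hW₀i⟩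
  refine ⟨pathComponentIn W₀ s₀, hW₀o.pathComponentIn s₀, mem_pathComponentIn_self hs₀W₀, fun t ht ↦ ?_⟩
  have hJ : JoinedIn W₀ s₀ t := ht
  set γ₀ : Path s₀ t := hJ.somePath
  have hγ : ∀ ρ, γ₀ ρ ∈ W₀ := hJ.somePath_mem
  have hγU : ∀ ρ, γ₀ ρ ∈ U := fun ρ ↦ (hγ ρ).1
  have hγi : ∀ i ρ, γ₀ ρ ∈ Wi i := fun i ρ ↦ Set.mem_iInter.1 (hγ ρ).2 i
  -- `W|_{𝒳_t}` is the transport of `W|_{𝒳_{s₀}}` along `γ₀` (in `U`)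
  have hWt : complexBetti.map (fiberι f t) (2 * m) W =
      transportFun f (2 * m) hU ⟦pathIn γ₀ U hγU⟧ (complexBetti.map (fiberι f s₀) (2 * m) W) :=
    (transportFun_map_fiberι f (2 * m) hU ⟦pathIn γ₀ U hγU⟧ W).symm
  have hlin : transportFun f (2 * m) hU ⟦pathIn γ₀ U hγU⟧ (∑ i, c i • C.ch (fiberOver f s₀) (E i) m) =
      ∑ i, c i • transportFun f (2 * m) hU ⟦pathIn γ₀ U hγU⟧ (C.ch (fiberOver f s₀) (E i) m) := by
    simp only [← transportLinear_apply, map_sum, map_smul]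
  rw [hWt, hsum, hlin]
  refine Submodule.sum_mem _ fun i _ ↦ Submodule.smul_mem _ (c i) ?_
  have hi := hWialg i ⟨t, hγi i 1 |> fun h ↦ γ₀.target ▸ h⟩ ⟦pathIn γ₀ (Wi i) (hγi i)⟧
  rw [transportFun_pathIn_mono f (2 * m) hU (hWiU i) (hWio i) γ₀ (hγi i)] at hi
  exact hi

/-! ### §4 Rows over CM fields of degree `> 2`: T7-germ-K, T6-CM-local, T6-CM-germ -/

/-- **T7-germ-K — `HC_CM` + CM-pointed `K`-Weil families + the semiregular Chern lift at CM fibres +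
Buchweitz–Flenner ⟹ R3 (every CM field `K` of degree `> 2`).** Kernel-checked composition of
`HC_WeilClassesCMField_of_HC_CM_local` with `localWeilVHCAtCMField_of_semiregularChernLift`. CONDITIONAL on `HC_CM`
(binder), two open Summit-side hypotheses (ours) and one refereed named fact (Buchweitz–Flenner 2003 Thm. 5.1,
unformalised). No preprint is an input of this row. [cite: BuchweitzFlenner2003, §5 Thm. 5.1]
[cite: CharlesSchnell2014Notes, Prop. 11.3.11 (proof)] [cite: Deligne1982HodgeCycles, §5] -/
theorem HC_WeilClassesCMField_of_HC_CM_of_semiregularChernLift (C : ChernCharacterBetti)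
    (hCM : Theses.RankFourFaces.CMAbelianHodge) (hP : CMPointedWeilFamiliesCMField)
    (hL : SemiregularChernLiftAtCMField C) (hBF : BuchweitzFlenner2003_variationalHodge_ISemiregular) :
    WeilClassesCMField :=
  HC_WeilClassesCMField_of_HC_CM_local hCM hP (localWeilVHCAtCMField_of_semiregularChernLift C hBF hL)

/-- **The `HC_CM`-FREE twin of T7-germ-K** through gen 2's divisor-generated CM anchors (anchor-good `K`).
[cite: Gordon1997, Thm. 6.4 and §3 Theorem] [cite: BuchweitzFlenner2003, §5 Thm. 5.1] -/
theorem HC_WeilClassesCMField_of_divisorGeneratedCMPointed_of_semiregularChernLift (C : ChernCharacterBetti)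
    (hP : DivisorGeneratedCMPointedWeilFamiliesCMField)
    (hL : SemiregularChernLiftAtCMField C) (hBF : BuchweitzFlenner2003_variationalHodge_ISemiregular) :
    WeilClassesCMField :=
  HC_WeilClassesCMField_of_divisorGeneratedCMPointed_local hP (localWeilVHCAtCMField_of_semiregularChernLift C hBF hL)

/-- **Row T6-CM-local: `HC_CM → CMPointedWeilFamiliesCMField → LocalWeilVHCAtCMField → (#24) → (MZ) → (descent) →
HodgeGeneralWeilTypeCMField`** — the class target T6-CM of gen 5 (the Hodge conjecture for every GENERAL Weil-type
abelian variety with respect to an arbitrary CM field `E`, `[E:ℚ] ≥ 4`; Deligne's endnote, fact #24, UNREFEREED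
(Milne 2003 endnote 16; Milne 2025 Ex. 1.17)) from the LOCAL germ instead of R3var, through gen 5's
`hodgeGeneralWeilTypeCMField_of_weilClassesCMField`. The descent binder `WeilClassesFieldRationallySpanned` is
discharged, in the irreducible instance the row needs, by `Literature/…/WeilClassesFieldRationalSpan.lean`
(`weilClassesField_le_span_isRationalClass`); the binder-free form of this row is then one line over
`Theorems/Ring2TransportWeilTypeGeneralCMFieldDescent.lean`. [cite: Deligne1982HodgeCycles, §4 (4.4), Prop. 4.4, endnote 16]
[cite: MoonenZarhin1998WeilClasses, §1 (Lemma (1), Criterion)] [cite: CharlesSchnell2014Notes, Prop. 11.3.11 (proof)] -/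
theorem HC_GeneralWeilTypeCMField_of_HC_CM_local (hCM : Theses.RankFourFaces.CMAbelianHodge)
    (hP : CMPointedWeilFamiliesCMField) (hL : LocalWeilVHCAtCMField)
    (h24 : Deligne1982_hodgeRing_weilTypeCM_of_hodgeGroupSU) (hMZ : MoonenZarhin1998_weilClasses_hodgeCriterion)
    (hQ : WeilClassesFieldRationallySpanned) : HodgeGeneralWeilTypeCMField :=
  hodgeGeneralWeilTypeCMField_of_weilClassesCMField h24 hMZ hQ (HC_WeilClassesCMField_of_HC_CM_local hCM hP hL)

/-- **Row T6-CM-germ: `HC_CM → CMPointedWeilFamiliesCMField → SemiregularChernLiftAtCMField C → BF2003 → (#24) →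
(MZ) → (descent) → HodgeGeneralWeilTypeCMField`.** [cite: BuchweitzFlenner2003, §5 Thm. 5.1]
[cite: Deligne1982HodgeCycles, §4 (4.4), Prop. 4.4, endnote 16] [cite: MoonenZarhin1998WeilClasses, §1] -/
theorem HC_GeneralWeilTypeCMField_of_HC_CM_of_semiregularChernLift (C : ChernCharacterBetti)
    (hCM : Theses.RankFourFaces.CMAbelianHodge) (hP : CMPointedWeilFamiliesCMField)
    (hL : SemiregularChernLiftAtCMField C) (hBF : BuchweitzFlenner2003_variationalHodge_ISemiregular)
    (h24 : Deligne1982_hodgeRing_weilTypeCM_of_hodgeGroupSU) (hMZ : MoonenZarhin1998_weilClasses_hodgeCriterion)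
    (hQ : WeilClassesFieldRationallySpanned) : HodgeGeneralWeilTypeCMField :=
  HC_GeneralWeilTypeCMField_of_HC_CM_local hCM hP (localWeilVHCAtCMField_of_semiregularChernLift C hBF hL) h24 hMZ hQ

/-- **Row T6-CM-local WITHOUT `HC_CM`** (gen 2's divisor-generated CM anchors; anchor-good `K`).
[cite: Gordon1997, Thm. 6.4] [cite: Deligne1982HodgeCycles, §4 (4.4), Prop. 4.4, endnote 16] -/
theorem HC_GeneralWeilTypeCMField_of_divisorGeneratedCMPointed_local (hP : DivisorGeneratedCMPointedWeilFamiliesCMField)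
    (hL : LocalWeilVHCAtCMField)
    (h24 : Deligne1982_hodgeRing_weilTypeCM_of_hodgeGroupSU) (hMZ : MoonenZarhin1998_weilClasses_hodgeCriterion)
    (hQ : WeilClassesFieldRationallySpanned) : HodgeGeneralWeilTypeCMField :=
  hodgeGeneralWeilTypeCMField_of_weilClassesCMField h24 hMZ hQ (HC_WeilClassesCMField_of_divisorGeneratedCMPointed_local hP hL)

/-- **Position of the CM-field germ rows** (kernel-checked conjunction): the local leaf is a case of the summit and is
implied by R3var; the semiregular Chern lift reaches it through the refereed germ theorem only.
[cite: CharlesSchnell2014Notes, Conj. 11.3.1 and Cor. 11.3.6] [cite: BuchweitzFlenner2003, §5 Thm. 5.1] -/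
theorem localGermCMField_position (C : ChernCharacterBetti) :
    (_root_.HodgeConjecture → LocalWeilVHCAtCMField) ∧
    (WeilVariationalHodgeCMField → LocalWeilVHCAtCMField) ∧
    (BuchweitzFlenner2003_variationalHodge_ISemiregular → SemiregularChernLiftAtCMField C → LocalWeilVHCAtCMField) ∧
    (Theses.RankFourFaces.CMAbelianHodge → CMPointedWeilFamiliesCMField → LocalWeilVHCAtCMField →
      WeilClassesCMField) :=
  ⟨localWeilVHCAtCMField_of_hodgeConjecture, localWeilVHCAtCMField_of_weilVariationalHodgeCMField,
    localWeilVHCAtCMField_of_semiregularChernLift C, HC_WeilClassesCMField_of_HC_CM_local⟩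

/-! ## Audit: nothing is decided here — every theorem whose conclusion is a Weil rung or the class target has among its
hypotheses an OPEN statement (`LocalWeilVHCAtCMField` / `SemiregularChernLiftAtCMField C`, ours; the CM-pointed families,
ours; on the T6-CM rows the unformalised facts #24 (UNREFEREED ×2), Moonen–Zarhin and the descent binder), the
refereed but unformalised fact `BuchweitzFlenner2003_variationalHodge_ISemiregular` on the germ rows, and on the
`HC_CM` rows `HC_CM` by name. Axiom closures: the three standard axioms only. -/

#print axioms Summit.HodgeConjecture.HodgeConjecture.Ring2Transport.HC_WeilClassesCMField_of_HC_CM_local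
#print axioms Summit.HodgeConjecture.HodgeConjecture.Ring2Transport.localWeilVHCAtCMField_of_semiregularChernLift
#print axioms Summit.HodgeConjecture.HodgeConjecture.Ring2Transport.HC_GeneralWeilTypeCMField_of_HC_CM_of_semiregularChernLift

end Summit.HodgeConjecture.HodgeConjecture.Ring2Transport

end
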